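import Mathlib
import HarnessLib
import Summits.Ventures.LatticeQCDFlow.Exactness.U1LeapfrogHMC

/-!
# The moments of the engine's `U(1)` momentum refresh law: `E|p_l| = 1/√(πκ)`, `E p_l² = 1/(2κ)`, `E Σ_l|p_l| = |ι|/√(πκ)`, `E (Σ_l|p_l|)² ≤ |ι|²/(2κ)` — the Gaussian inputs of a MEAN acceptance bound on the `U(1)` rung

HONEST FRAMING: exact (Metropolis-corrected) sampling algorithms for lattice gauge theory;
figures of merit are autocorrelation/cost numbers at stated couplings and volumes; no
continuum-physics claim.

Venture `LatticeQCDFlow` (cell pub-lqcd), topic `Exactness`; FANOUT row 14 (`eng-flowhmc`, engine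
`latflow.fthmc`, family B, `U(1)` rung; the pointwise energy-error law of `U1LeapfrogEnergyError` is a polynomial
in `‖p‖`, `Σ_l|p_l|` — averaging it over the refresh needs exactly these moments).  The `U(1)` twin of
`SU2MomentumLawMoments`.  NEW WORK of the cell over the tree (row 9's `U1LeapfrogHMC`: `u1Kinetic κ p = κΣ_l|p_l|²`,
`u1MomentumWeight κ = e^{−T_κ}·Lebesgue`, `u1MomentumLaw κ = Z⁻¹·u1MomentumWeight κ`, `u1MomentumWeight_univ`;
`StdGaussianRadial.lintegral_prod_pi`) and Mathlib (`integral_fun_norm_addHaar` in dimension one, the Gamma integral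
`integral_rpow_mul_exp_neg_mul_rpow`, `Real.Gamma_one_half_eq`, `integral_gaussian`); nothing is cited as a fact; no
number beyond the closed forms.

* §1 (one link, `ℝ`, `κ > 0`) **`integral_norm_pow_mul_exp_neg_mul_sq_norm_real1`** —
  `∫ |v|^k e^{−κv²} dv = |B₁|·(κ^{−(k+1)/2}·½·Γ((k+1)/2))` for every `k : ℕ`;
  **`integral_norm_sq_mul_exp_neg_mul_sq_norm_real1`** (`∫ v² e^{−κv²} = (1/(2κ))·∫ e^{−κv²}`),
  **`integral_norm_mul_exp_neg_mul_sq_norm_real1`** (`∫ |v| e^{−κv²} = (1/√(πκ))·∫ e^{−κv²}`),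
  `integrable_norm_pow_mul_exp_neg_mul_sq_norm_real1`, `integral_exp_neg_mul_sq_norm_real1_eq` (`= √(π/κ)`), `_pos`.
* §2 (the product law on `ℝ^ι`) **`lintegral_norm_apply_pow_u1MomentumWeight`** (Tonelli over the links),
  **`integral_norm_apply_pow_u1MomentumLaw`** (`E|p_l|^k` = the one-link ratio), `integrable_norm_apply_pow_u1MomentumLaw`,
  **`integral_norm_apply_sq_u1MomentumLaw`** (`E p_l² = 1/(2κ)`), **`integral_norm_apply_u1MomentumLaw`** (`E|p_l| = 1/√(πκ)`),
  **`integral_sum_norm_u1MomentumLaw`** (`E Σ_l|p_l| = |ι|/√(πκ)`), **`integral_sq_sum_norm_u1MomentumLaw_le`**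
  (`E (Σ_l|p_l|)² ≤ |ι|²/(2κ)`, Cauchy–Schwarz over the links).

NOT CLAIMED: higher moments; anything about the configuration marginal; any number beyond these closed forms.
-/

noncomputable section

namespace Summit.Ventures.LatticeQCDFlow.Exactness

open Set MeasureTheory Metric
open scoped ENNReal

/-! ## §1 Gaussian moments on `ℝ` (the one-link momentum of the `U(1)` rung) -/

section OneLink

/-- **`∫_ℝ |v|^k e^{−κv²} dv = |B₁|·(κ^{−(k+1)/2}·½·Γ((k+1)/2))`** (`|B₁| = 2`; polar coordinates in dimension
one + the Gamma integral). -/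
theorem integral_norm_pow_mul_exp_neg_mul_sq_norm_real1 {κ : ℝ} (hκ : 0 < κ) (k : ℕ) :
    ∫ v : ℝ, ‖v‖ ^ k * Real.exp (-κ * ‖v‖ ^ 2) =
      (volume : Measure ℝ).real (ball 0 1) *
        (κ ^ (-((k : ℝ) + 1) / 2) * (1 / 2) * Real.Gamma (((k : ℝ) + 1) / 2)) := by
  have h := integral_fun_norm_addHaar (volume : Measure ℝ) (fun y : ℝ => y ^ k * Real.exp (-κ * y ^ 2))
  rw [h, Module.finrank_self, one_smul, smul_eq_mul]
  have hI : ∫ y in Ioi (0 : ℝ), y ^ (1 - 1) • (y ^ k * Real.exp (-κ * y ^ 2)) =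
      κ ^ (-((k : ℝ) + 1) / 2) * (1 / 2) * Real.Gamma (((k : ℝ) + 1) / 2) := by
    have hG := integral_rpow_mul_exp_neg_mul_rpow (p := 2) (q := (k : ℝ)) two_pos
      (by have := (Nat.cast_nonneg k : (0 : ℝ) ≤ k); linarith) hκ
    rw [← hG]
    refine setIntegral_congr_fun measurableSet_Ioi fun y hy => ?_
    have hy' : (0 : ℝ) ≤ y := le_of_lt hy
    simp only [Nat.sub_self, pow_zero, one_smul]
    rw [Real.rpow_natCast, show (2 : ℝ) = ((2 : ℕ) : ℝ) by norm_num, Real.rpow_natCast]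
  rw [hI]

/-- `∫_ℝ e^{−κv²} dv` in the same radial form (`k = 0`). -/
theorem integral_exp_neg_mul_sq_norm_real1_radial {κ : ℝ} (hκ : 0 < κ) :
    ∫ v : ℝ, Real.exp (-κ * ‖v‖ ^ 2) =
      (volume : Measure ℝ).real (ball 0 1) * (κ ^ (-(1 : ℝ) / 2) * (1 / 2) * Real.Gamma ((1 : ℝ) / 2)) := by
  have h := integral_norm_pow_mul_exp_neg_mul_sq_norm_real1 hκ 0
  simp only [pow_zero, one_mul, Nat.cast_zero, zero_add] at h
  exact h

/-- **The second moment: `∫ v² e^{−κv²} = (1/(2κ)) ∫ e^{−κv²}`** (`Γ(3/2) = (1/2)Γ(1/2)`). -/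
theorem integral_norm_sq_mul_exp_neg_mul_sq_norm_real1 {κ : ℝ} (hκ : 0 < κ) :
    ∫ v : ℝ, ‖v‖ ^ 2 * Real.exp (-κ * ‖v‖ ^ 2) = 1 / (2 * κ) * ∫ v : ℝ, Real.exp (-κ * ‖v‖ ^ 2) := by
  rw [integral_norm_pow_mul_exp_neg_mul_sq_norm_real1 hκ 2, integral_exp_neg_mul_sq_norm_real1_radial hκ]
  have h5 : Real.Gamma ((((2 : ℕ) : ℝ) + 1) / 2) = 1 / 2 * Real.Gamma ((1 : ℝ) / 2) := by
    rw [show (((2 : ℕ) : ℝ) + 1) / 2 = (1 : ℝ) / 2 + 1 by norm_num]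
    exact Real.Gamma_add_one (by norm_num)
  have hk : κ ^ (-(((2 : ℕ) : ℝ) + 1) / 2) = κ ^ (-(1 : ℝ) / 2) * κ⁻¹ := by
    rw [show (-(((2 : ℕ) : ℝ) + 1) / 2) = (-(1 : ℝ) / 2) + (-1) by norm_num, Real.rpow_add hκ, Real.rpow_neg_one]
  rw [h5, hk]
  field_simp

/-- **The first absolute moment: `∫ |v| e^{−κv²} = (1/√(πκ)) ∫ e^{−κv²}`** (`Γ(1) = 1`, `Γ(1/2) = √π`). -/
theorem integral_norm_mul_exp_neg_mul_sq_norm_real1 {κ : ℝ} (hκ : 0 < κ) :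
    ∫ v : ℝ, ‖v‖ * Real.exp (-κ * ‖v‖ ^ 2) = 1 / Real.sqrt (Real.pi * κ) * ∫ v : ℝ, Real.exp (-κ * ‖v‖ ^ 2) := by
  have h := integral_norm_pow_mul_exp_neg_mul_sq_norm_real1 hκ 1
  simp only [pow_one, Nat.cast_one] at h
  rw [h, integral_exp_neg_mul_sq_norm_real1_radial hκ]
  have h2 : Real.Gamma (((1 : ℝ) + 1) / 2) = 1 := by
    rw [show ((1 : ℝ) + 1) / 2 = 1 by norm_num, Real.Gamma_one]
  have hk : κ ^ (-((1 : ℝ) + 1) / 2) = κ ^ (-(1 : ℝ) / 2) * (Real.sqrt κ)⁻¹ := by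
    rw [show (-((1 : ℝ) + 1) / 2) = (-(1 : ℝ) / 2) + (-(1 / 2)) by norm_num, Real.rpow_add hκ,
      Real.rpow_neg hκ.le, Real.sqrt_eq_rpow]
  have hpi : Real.sqrt (Real.pi * κ) = Real.sqrt Real.pi * Real.sqrt κ := Real.sqrt_mul Real.pi_pos.le κ
  have hsπ : Real.sqrt Real.pi ≠ 0 := (Real.sqrt_pos.2 Real.pi_pos).ne'
  have hsκ : Real.sqrt κ ≠ 0 := (Real.sqrt_pos.2 hκ).ne'
  rw [h2, Real.Gamma_one_half_eq, hk, hpi]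
  field_simp

/-- `v ↦ |v|^k e^{−κv²}` is integrable on `ℝ`. -/
theorem integrable_norm_pow_mul_exp_neg_mul_sq_norm_real1 {κ : ℝ} (hκ : 0 < κ) (k : ℕ) :
    Integrable (fun v : ℝ => ‖v‖ ^ k * Real.exp (-κ * ‖v‖ ^ 2)) := by
  have h := (integrable_fun_norm_addHaar (volume : Measure ℝ)
    (f := fun y : ℝ => y ^ k * Real.exp (-κ * y ^ 2))).2
  refine h ?_
  rw [Module.finrank_self]
  have hI := integrableOn_rpow_mul_exp_neg_mul_sq hκ (s := (k : ℝ))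
    (by have := (Nat.cast_nonneg k : (0 : ℝ) ≤ k); linarith)
  refine (integrableOn_congr_fun (fun y hy => ?_) measurableSet_Ioi).1 hI
  simp only [Nat.sub_self, pow_zero, one_smul]
  rw [Real.rpow_natCast]

end OneLink

/-! ## §2 The product law `u1MomentumLaw κ` on `ℝ^ι`: one-link moments, `E Σ_l‖p_l‖`, `E (Σ_l‖p_l‖)²` -/

section Product

variable {ι : Type*} [Fintype ι] [DecidableEq ι]

/-- **Tonelli over the links for a one-link observable**: `∫ |p_l|^k e^{−T_κ(p)} dp = (∫_ℝ |v|^k e^{−κv²})·(∫_ℝ e^{−κv²})^{|ι|−1}`. -/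
theorem lintegral_norm_apply_pow_u1MomentumWeight {κ : ℝ} (hκ : 0 < κ) (k : ℕ) (l : ι) :
    ∫⁻ p, ENNReal.ofReal (‖p l‖ ^ k) ∂(u1MomentumWeight (ι := ι) κ) =
      ENNReal.ofReal (∫ v : ℝ, ‖v‖ ^ k * Real.exp (-κ * ‖v‖ ^ 2)) *
        ENNReal.ofReal (∫ v : ℝ, Real.exp (-κ * ‖v‖ ^ 2)) ^ (Fintype.card ι - 1) := by
  have hmw : Measurable fun v : ℝ => ENNReal.ofReal (Real.exp (-κ * ‖v‖ ^ 2)) :=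
    (Real.measurable_exp.comp (measurable_const.mul (measurable_norm.pow_const 2))).ennreal_ofReal
  have hmk : Measurable fun v : ℝ => ENNReal.ofReal (‖v‖ ^ k * Real.exp (-κ * ‖v‖ ^ 2)) :=
    ((measurable_norm.pow_const k).mul (Real.measurable_exp.comp (measurable_const.mul (measurable_norm.pow_const 2)))).ennreal_ofReal
  -- the factorised integrand
  set F : ι → ℝ → ℝ≥0∞ := fun m v =>
    if m = l then ENNReal.ofReal (‖v‖ ^ k * Real.exp (-κ * ‖v‖ ^ 2)) else ENNReal.ofReal (Real.exp (-κ * ‖v‖ ^ 2)) with hF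
  have hFm : ∀ m, Measurable (F m) := by
    intro m
    by_cases hm : m = l
    · simp only [hF, hm, if_true]; exact hmk
    · simp only [hF, hm, if_false]; exact hmw
  have hdens : ∀ p : ι → ℝ,
      ENNReal.ofReal (Real.exp (-u1Kinetic κ p)) * ENNReal.ofReal (‖p l‖ ^ k) = ∏ m, F m (p m) := by
    intro p
    have h1 : ENNReal.ofReal (Real.exp (-u1Kinetic κ p)) = ∏ m, ENNReal.ofReal (Real.exp (-κ * ‖p m‖ ^ 2)) := by
      rw [← ENNReal.ofReal_prod_of_nonneg (fun m _ => (Real.exp_pos _).le), ← Real.exp_sum]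
      congr 2
      rw [u1Kinetic, Finset.mul_sum Finset.univ (fun m => ‖p m‖ ^ 2) κ, ← Finset.sum_neg_distrib]
      exact Finset.sum_congr rfl fun m _ => by ring
    rw [h1, ← Finset.mul_prod_erase Finset.univ (fun m => ENNReal.ofReal (Real.exp (-κ * ‖p m‖ ^ 2))) (Finset.mem_univ l),
      ← Finset.mul_prod_erase Finset.univ (fun m => F m (p m)) (Finset.mem_univ l)]
    have hl : F l (p l) = ENNReal.ofReal (‖p l‖ ^ k * Real.exp (-κ * ‖p l‖ ^ 2)) := by simp only [hF, if_true]
    have hrest : ∏ m ∈ Finset.univ.erase l, F m (p m) = ∏ m ∈ Finset.univ.erase l, ENNReal.ofReal (Real.exp (-κ * ‖p m‖ ^ 2)) := by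
      refine Finset.prod_congr rfl fun m hm => ?_
      have hml : m ≠ l := Finset.ne_of_mem_erase hm
      simp only [hF, hml, if_false]
    rw [hl, hrest, ENNReal.ofReal_mul (pow_nonneg (norm_nonneg _) k)]
    ring
  have hmd : Measurable (fun p : ι → ℝ => ENNReal.ofReal (Real.exp (-u1Kinetic κ p))) :=
    (measurable_u1Kinetic κ).neg.exp.ennreal_ofReal
  rw [u1MomentumWeight, lintegral_withDensity_eq_lintegral_mul _ hmd ((measurable_pi_apply l).norm.pow_const k).ennreal_ofReal]
  simp only [Pi.mul_apply]
  simp_rw [hdens]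
  rw [volume_pi, lintegral_prod_pi (fun _ : ι => (volume : Measure (ℝ))) hFm,
    ← Finset.mul_prod_erase Finset.univ (fun m => ∫⁻ v, F m v) (Finset.mem_univ l)]
  have hl : ∫⁻ v, F l v = ENNReal.ofReal (∫ v : ℝ, ‖v‖ ^ k * Real.exp (-κ * ‖v‖ ^ 2)) := by
    simp only [hF, if_true]
    rw [← ofReal_integral_eq_lintegral_ofReal (integrable_norm_pow_mul_exp_neg_mul_sq_norm_real1 hκ k)
      (Filter.Eventually.of_forall fun v => by positivity)]
  have hrest : ∏ m ∈ Finset.univ.erase l, ∫⁻ v, F m v =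
      ENNReal.ofReal (∫ v : ℝ, Real.exp (-κ * ‖v‖ ^ 2)) ^ (Fintype.card ι - 1) := by
    rw [← Finset.card_univ, ← Finset.card_erase_of_mem (Finset.mem_univ l), ← Finset.prod_const]
    refine Finset.prod_congr rfl fun m hm => ?_
    have hml : m ≠ l := Finset.ne_of_mem_erase hm
    simp only [hF, hml, if_false]
    have hi := integrable_norm_pow_mul_exp_neg_mul_sq_norm_real1 hκ 0
    simp only [pow_zero, one_mul] at hi
    rw [← ofReal_integral_eq_lintegral_ofReal hi (Filter.Eventually.of_forall fun v => (Real.exp_pos _).le)]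
  rw [hl, hrest]

/-- `∫_ℝ e^{−κv²} dv = √(π/κ)`. -/
theorem integral_exp_neg_mul_sq_norm_real1_eq (κ : ℝ) :
    ∫ v : ℝ, Real.exp (-κ * ‖v‖ ^ 2) = Real.sqrt (Real.pi / κ) := by
  have hnorm : (fun v : ℝ => Real.exp (-κ * ‖v‖ ^ 2)) = fun v => Real.exp (-κ * v ^ 2) := by
    funext v
    rw [Real.norm_eq_abs, sq_abs]
  rw [hnorm, integral_gaussian]

/-- `∫_ℝ e^{−κv²} dv > 0`. -/
theorem integral_exp_neg_mul_sq_norm_real1_pos {κ : ℝ} (hκ : 0 < κ) :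
    0 < ∫ v : ℝ, Real.exp (-κ * ‖v‖ ^ 2) := by
  rw [integral_exp_neg_mul_sq_norm_real1_eq κ]
  exact Real.sqrt_pos.2 (by positivity)

/-- **THE ONE-LINK MOMENTS OF THE MOMENTUM LAW ARE THE RADIAL GAUSSIAN RATIOS**:
`E_{u1MomentumLaw κ} |p_l|^k = (∫_ℝ |v|^k e^{−κv²}) / (∫_ℝ e^{−κv²})`. -/
theorem integral_norm_apply_pow_u1MomentumLaw {κ : ℝ} (hκ : 0 < κ) (k : ℕ) (l : ι) :
    ∫ p, ‖p l‖ ^ k ∂(u1MomentumLaw (ι := ι) κ) =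
      (∫ v : ℝ, ‖v‖ ^ k * Real.exp (-κ * ‖v‖ ^ 2)) /
        ∫ v : ℝ, Real.exp (-κ * ‖v‖ ^ 2) := by
  have hJ0 := integral_exp_neg_mul_sq_norm_real1_pos hκ
  have hJ0v : ∫ v : ℝ, Real.exp (-κ * ‖v‖ ^ 2) = Real.sqrt (Real.pi / κ) := integral_exp_neg_mul_sq_norm_real1_eq κ
  have hJk : 0 ≤ ∫ v : ℝ, ‖v‖ ^ k * Real.exp (-κ * ‖v‖ ^ 2) :=
    integral_nonneg fun v => by positivity
  have hmeas : Measurable fun p : ι → ℝ => ‖p l‖ ^ k := (measurable_pi_apply l).norm.pow_const k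
  rw [integral_eq_lintegral_of_nonneg_ae (Filter.Eventually.of_forall fun p => by positivity) hmeas.aestronglyMeasurable,
    u1MomentumLaw, lintegral_smul_measure, lintegral_norm_apply_pow_u1MomentumWeight hκ k l, u1MomentumWeight_univ hκ,
    ← hJ0v, smul_eq_mul]
  rw [ENNReal.toReal_mul, ENNReal.toReal_mul, ENNReal.toReal_inv, ENNReal.toReal_pow, ENNReal.toReal_pow,
    ENNReal.toReal_ofReal hJk, ENNReal.toReal_ofReal hJ0.le]
  set A := ∫ v : ℝ, Real.exp (-κ * ‖v‖ ^ 2) with hA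
  set J := ∫ v : ℝ, ‖v‖ ^ k * Real.exp (-κ * ‖v‖ ^ 2) with hJ
  have hc : Fintype.card ι = (Fintype.card ι - 1) + 1 :=
    (Nat.succ_pred_eq_of_pos (Fintype.card_pos_iff.2 ⟨l⟩)).symm
  have hAne : A ≠ 0 := hJ0.ne'
  have hAc : A ^ (Fintype.card ι - 1) ≠ 0 := pow_ne_zero _ hAne
  rw [hc, pow_succ, Nat.add_sub_cancel]
  field_simp

/-- The one-link observables `‖p_l‖^k` are integrable under the momentum law. -/
theorem integrable_norm_apply_pow_u1MomentumLaw {κ : ℝ} (hκ : 0 < κ) (k : ℕ) (l : ι) :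
    Integrable (fun p : ι → ℝ => ‖p l‖ ^ k) (u1MomentumLaw (ι := ι) κ) := by
  have hmeas : Measurable fun p : ι → ℝ => ‖p l‖ ^ k := (measurable_pi_apply l).norm.pow_const k
  refine ⟨hmeas.aestronglyMeasurable, (hasFiniteIntegral_iff_ofReal (Filter.Eventually.of_forall fun p => by positivity)).2 ?_⟩
  rw [u1MomentumLaw, lintegral_smul_measure, lintegral_norm_apply_pow_u1MomentumWeight hκ k l, smul_eq_mul]
  refine ENNReal.mul_lt_top ?_ ?_
  · exact ENNReal.inv_lt_top.2 (pos_iff_ne_zero.2 (u1MomentumWeight_univ_ne_zero hκ))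
  · exact ENNReal.mul_lt_top ENNReal.ofReal_lt_top (ENNReal.pow_lt_top ENNReal.ofReal_lt_top)

/-- **`E p_l² = 1/(2κ)`** under `u1MomentumLaw κ` (each `p_l ∼ N(0, (2κ)⁻¹)`). -/
theorem integral_norm_apply_sq_u1MomentumLaw {κ : ℝ} (hκ : 0 < κ) (l : ι) :
    ∫ p, ‖p l‖ ^ 2 ∂(u1MomentumLaw (ι := ι) κ) = 1 / (2 * κ) := by
  rw [integral_norm_apply_pow_u1MomentumLaw hκ 2 l, integral_norm_sq_mul_exp_neg_mul_sq_norm_real1 hκ,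
    mul_div_assoc, div_self (integral_exp_neg_mul_sq_norm_real1_pos hκ).ne', mul_one]

/-- **`E |p_l| = 1/√(πκ)`** under `u1MomentumLaw κ`. -/
theorem integral_norm_apply_u1MomentumLaw {κ : ℝ} (hκ : 0 < κ) (l : ι) :
    ∫ p, ‖p l‖ ∂(u1MomentumLaw (ι := ι) κ) = 1 / Real.sqrt (Real.pi * κ) := by
  have h := integral_norm_apply_pow_u1MomentumLaw (ι := ι) hκ 1 l
  simp only [pow_one] at h
  rw [h, integral_norm_mul_exp_neg_mul_sq_norm_real1 hκ, mul_div_assoc,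
    div_self (integral_exp_neg_mul_sq_norm_real1_pos hκ).ne', mul_one]

/-- **`E Σ_l |p_l| = |ι|/√(πκ)`**. -/
theorem integral_sum_norm_u1MomentumLaw {κ : ℝ} (hκ : 0 < κ) :
    ∫ p, ∑ l, ‖p l‖ ∂(u1MomentumLaw (ι := ι) κ) = Fintype.card ι * (1 / Real.sqrt (Real.pi * κ)) := by
  rw [integral_finsetSum _ fun l _ => by simpa only [pow_one] using integrable_norm_apply_pow_u1MomentumLaw (ι := ι) hκ 1 l]
  simp only [integral_norm_apply_u1MomentumLaw hκ, Finset.sum_const, Finset.card_univ, nsmul_eq_mul]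

/-- **`E (Σ_l |p_l|)² ≤ |ι|²/(2κ)`** (Cauchy–Schwarz over the links). -/
theorem integral_sq_sum_norm_u1MomentumLaw_le {κ : ℝ} (hκ : 0 < κ) :
    ∫ p, (∑ l, ‖p l‖) ^ 2 ∂(u1MomentumLaw (ι := ι) κ) ≤ (Fintype.card ι : ℝ) ^ 2 * (1 / (2 * κ)) := by
  haveI : Fact (0 < κ) := ⟨hκ⟩
  have hint2 : Integrable (fun p : ι → ℝ => (Fintype.card ι : ℝ) * ∑ l, ‖p l‖ ^ 2) (u1MomentumLaw (ι := ι) κ) :=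
    (integrable_finsetSum _ fun l _ => integrable_norm_apply_pow_u1MomentumLaw (ι := ι) hκ 2 l).const_mul _
  have hle : ∀ p : ι → ℝ, (∑ l, ‖p l‖) ^ 2 ≤ (Fintype.card ι : ℝ) * ∑ l, ‖p l‖ ^ 2 := by
    intro p
    have h := sq_sum_le_card_mul_sum_sq (s := Finset.univ) (f := fun l => ‖p l‖)
    simpa only [Finset.card_univ] using h
  have hmeas : Measurable fun p : ι → ℝ => (∑ l, ‖p l‖) ^ 2 :=
    (Finset.measurable_sum _ fun l _ => (measurable_pi_apply l).norm).pow_const 2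
  have hint1 : Integrable (fun p : ι → ℝ => (∑ l, ‖p l‖) ^ 2) (u1MomentumLaw (ι := ι) κ) :=
    hint2.mono' hmeas.aestronglyMeasurable (Filter.Eventually.of_forall fun p => by
      rw [Real.norm_eq_abs, abs_of_nonneg (sq_nonneg _)]; exact hle p)
  calc ∫ p, (∑ l, ‖p l‖) ^ 2 ∂(u1MomentumLaw (ι := ι) κ)
      ≤ ∫ p, (Fintype.card ι : ℝ) * ∑ l, ‖p l‖ ^ 2 ∂(u1MomentumLaw (ι := ι) κ) := integral_mono hint1 hint2 hle
    _ = (Fintype.card ι : ℝ) ^ 2 * (1 / (2 * κ)) := by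
        rw [integral_const_mul, integral_finsetSum _ fun l _ => integrable_norm_apply_pow_u1MomentumLaw (ι := ι) hκ 2 l]
        simp only [integral_norm_apply_sq_u1MomentumLaw hκ, Finset.sum_const, Finset.card_univ, nsmul_eq_mul]
        ring

end Product


end Summit.Ventures.LatticeQCDFlow.Exactness
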